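import Summits.Parity.BatemanHorn.Theorems.SelbergDelangeRigidityLSDRealSegmentTailsTwoEngineAux
import HarnessLib

/-!
# Route `SelbergDelangeRigidity`, crux `LSDRealSegment` (stmt-Parity-9770), line
# `product-anatomy-subcritical`: eventual side conditions of the restoration engine (`stub_tailsTwo`)

The engine of the small-prime restoration (`…TailsTwoEngine`) needs, for all large `X`, that `X^θ` dominates the
constants: `16 P# ≤ X^θ` (the classes are long), `P# (c+1) X^{θ/4} ≤ X^θ` (the height condition of
Nair–Tenenbaum, heights `≪ X²`, `δ = θ/8`), and `log(4 P#) ≤ (θ/2) log X` (the sieve product at the class length).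
`tailsTwo_engine_eventually` (registered helper) packages these with the thresholds of the sparse part and of positivity.
-/

open Filter Finset Polynomial
open scoped BigOperators Topology Classical

namespace Summit.Parity.BatemanHorn.Cruxes.LSDRealSegment.ProductAnatomySubcritical

open Literature.NumberTheory.Sieve
open ArithmeticFunction (cardFactors)
noncomputable section

/-- **tailsTwo_engine_eventually** (registered helper of `stub_tailsTwo`, line `product-anatomy-subcritical`): eventually in
`X`, the side conditions of the restoration engine (`X^θ` dominates `16 K`, `K (c+1) X^{θ/4}` and `log(4K) ≤ (θ/2) log X`),
together with two thresholds. [folklore] -/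
theorem tailsTwo_engine_eventually : ∀ (θ c K : ℝ), 0 < θ → ∀ (X₁ n₀ : ℕ),
    ∃ X₀ : ℕ, ∀ X : ℕ, X₀ ≤ X → X₁ ≤ X ∧ n₀ ≤ X ∧ 2 ≤ X ∧ 16 * K ≤ (X : ℝ) ^ θ ∧
      K * ((c + 1) * (X : ℝ) ^ (θ / 4)) ≤ (X : ℝ) ^ θ ∧ Real.log (4 * K) ≤ θ / 2 * Real.log X := by
  intro θ c K hθ X₁ n₀
  have hθ4 : 0 < 3 * θ / 4 := by positivity
  have e1 : ∀ᶠ X : ℕ in atTop, 16 * K ≤ (X : ℝ) ^ θ :=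
    ((tendsto_rpow_atTop hθ).comp tendsto_natCast_atTop_atTop).eventually_ge_atTop _
  have e2 : ∀ᶠ X : ℕ in atTop, K * (c + 1) ≤ (X : ℝ) ^ (3 * θ / 4) :=
    ((tendsto_rpow_atTop hθ4).comp tendsto_natCast_atTop_atTop).eventually_ge_atTop _
  have e3 : ∀ᶠ X : ℕ in atTop, Real.log (4 * K) * (2 / θ) ≤ Real.log X :=
    (Real.tendsto_log_atTop.comp tendsto_natCast_atTop_atTop).eventually_ge_atTop _
  obtain ⟨X₀, hX₀⟩ := Filter.eventually_atTop.mp (e1.and (e2.and (e3.and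
    ((eventually_ge_atTop X₁).and ((eventually_ge_atTop n₀).and (eventually_ge_atTop 2))))))
  refine ⟨X₀, fun X hX => ?_⟩
  obtain ⟨h1, h2, h3, h4, h5, h6⟩ := hX₀ X hX
  have hXpos : (0 : ℝ) < X := by exact_mod_cast (show 0 < X by omega)
  refine ⟨h4, h5, h6, h1, ?_, ?_⟩
  · calc K * ((c + 1) * (X : ℝ) ^ (θ / 4)) = (K * (c + 1)) * (X : ℝ) ^ (θ / 4) := by ring
      _ ≤ (X : ℝ) ^ (3 * θ / 4) * (X : ℝ) ^ (θ / 4) := mul_le_mul_of_nonneg_right h2 (by positivity)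
      _ = (X : ℝ) ^ θ := by rw [← Real.rpow_add hXpos]; ring_nf
  · calc Real.log (4 * K) = Real.log (4 * K) * (2 / θ) * (θ / 2) := by field_simp
      _ ≤ Real.log X * (θ / 2) := mul_le_mul_of_nonneg_right h3 (by positivity)
      _ = θ / 2 * Real.log X := by ring

end

end Summit.Parity.BatemanHorn.Cruxes.LSDRealSegment.ProductAnatomySubcritical
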